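import Summits.ABC.StewartYu.GenThreeRecordNumerics
import HarnessLib

/-!
# Cell abc-stewartyu, Gen-3 record (WP-M3.R): the two constant comparisons `NC1`, `NC0` of clause (C)

`Summits/ABC/StewartYu/RecordNumericC.lean` — cell `abc-stewartyu` (HOME `run/shared/lean/pub/abc-stewartyu/`),
route `PadicPrimesKummerThird`, cruxes `Y07Odd` (stmt-ABC-19658) / `Y07Two` (stmt-ABC-19659); seat lp-1 (g2),
record parcel (R3), last numeric piece.  Theorems only.

The hypotheses `hnum1`/`hnum0` of `PadicG3Par.recordTwo_of_numeric` / `recordOdd_of_numeric`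
(`GenThreeRecordNumerics`) are pure real inequalities in `n, r`.  With `64 ≤ Cb ≤ 87` they follow from the
INTEGER inequalities (`λ ≤ (2^{4n}+2^{19})/2^{5n+23}`, `c_L ≤ 264·87ⁿ + 2^{2n+26}`, denominators cleared)

* `NC1nat n r : (r!)²nʳ(n+1)!2ʳ(r−1)!(2^{4n}+2^{19})ʳ(264·87ⁿ+2^{2n+26})(14n+3)(n+2)^{4(r−1)}
              ≤ 256^{n−r}(16(n+1))^{r−1}2^{n+22}(n−r+1)!·2^{r(5n+23)}`,
* `NC0nat n r : (r!)³nʳ(n+1)!2^{r−1}(2^{4n}+2^{19})ʳ(264·87ⁿ+2^{2n+26})(14n+3)(n+2)^{4r}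
              ≤ 256^{n−r}(16(n+1))ʳ2^{n+22}(n−r)!·2^{r(5n+23)}`,

proved by `decide` for `n ≤ 64` (kernel arithmetic; all `0 < r < n`) and by crude exponent counting for
`n ≥ 64` (`(n+2)⁸ ≤ 2ⁿ` there, so `(n+2)^{8r} ≤ 2^{nr}` absorbs every polynomial factor).  Then
`recordTwo_of_convention` / `recordOdd_of_convention`: `RecordTwo` / `RecordOdd` BY NAME for `PadicG3Par`
from the instantiation convention and an admissible geometric `C` ALONE.

WHAT THIS IS NOT: no crux moves.

References: Yu. V. Nesterenko, LNM 1819 (2003), §5.2 (5.22).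
-/

noncomputable section

open Finset Real Nat

namespace Summit.ABC.StewartYu

namespace RecordExitsNumeric

/-! ### Small `n`: kernel arithmetic -/

set_option exponentiation.threshold 1000000 in
set_option maxRecDepth 100000 in
/-- `NC1nat ∧ NC0nat` for `n ≤ 64`, all `0 < r < n` (decided by the kernel). [folklore] -/
theorem nc_small : ∀ n, n ≤ 64 → ∀ r, r < n → 0 < r →
    ((r ! ^ 2 * n ^ r * (n + 1)! * 2 ^ r * (r - 1)! * (2 ^ (4 * n) + 2 ^ 19) ^ r *
        (264 * 87 ^ n + 2 ^ (2 * n + 26)) * (14 * n + 3) * (n + 2) ^ (4 * (r - 1)) ≤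
      256 ^ (n - r) * (16 * (n + 1)) ^ (r - 1) * 2 ^ (n + 22) * (n - r + 1)! * 2 ^ (r * (5 * n + 23))) ∧
    (r ! ^ 3 * n ^ r * (n + 1)! * 2 ^ (r - 1) * (2 ^ (4 * n) + 2 ^ 19) ^ r *
        (264 * 87 ^ n + 2 ^ (2 * n + 26)) * (14 * n + 3) * (n + 2) ^ (4 * r) ≤
      256 ^ (n - r) * (16 * (n + 1)) ^ r * 2 ^ (n + 22) * (n - r)! * 2 ^ (r * (5 * n + 23)))) := by
  decide

/-! ### Large `n`: exponent counting -/

/-- `(n+2)⁸ ≤ 2ⁿ` for `n ≥ 64`. [folklore] -/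
theorem pow_eight_le_two_pow_self {n : ℕ} (hn : 64 ≤ n) : (n + 2) ^ 8 ≤ 2 ^ n := by
  induction n with
  | zero => omega
  | succ k ih =>
    rcases Nat.lt_or_ge k 64 with hk | hk
    · have : k = 63 := by omega
      subst this; norm_num
    · calc (k + 1 + 2) ^ 8 = (k + 2 + 1) ^ 8 := by ring
        _ ≤ 2 * (k + 2) ^ 8 := succ_pow_eight_le (by omega)
        _ ≤ 2 * 2 ^ k := Nat.mul_le_mul_left _ (ih hk)
        _ = 2 ^ (k + 1) := by ring

/-- The common crude bounds for `n ≥ 64`: `2^{4n}+2^{19} ≤ 2^{4n+1}`, `264·87ⁿ + 2^{2n+26} ≤ 2^{7n+10}`,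
`14n+3 ≤ 16(n+1)`, `(n+1)² ≤ 2ⁿ`. [folklore] -/
theorem crude_bounds {n : ℕ} (hn : 64 ≤ n) :
    2 ^ (4 * n) + 2 ^ 19 ≤ 2 ^ (4 * n + 1) ∧ 264 * 87 ^ n + 2 ^ (2 * n + 26) ≤ 2 ^ (7 * n + 10) ∧
    14 * n + 3 ≤ 16 * (n + 1) ∧ (n + 1) ^ 2 ≤ 2 ^ n := by
  refine ⟨?_, ?_, by omega, ?_⟩
  · have : 2 ^ 19 ≤ 2 ^ (4 * n) := Nat.pow_le_pow_right (by norm_num) (by omega)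
    rw [pow_succ]; omega
  · have h87 : 87 ^ n ≤ 2 ^ (7 * n) := by
      rw [pow_mul]; exact Nat.pow_le_pow_left (by norm_num) n
    have h1 : 264 * 87 ^ n ≤ 2 ^ (7 * n + 9) := by
      rw [pow_add]; calc 264 * 87 ^ n ≤ 512 * 2 ^ (7 * n) := Nat.mul_le_mul (by norm_num) h87
        _ = 2 ^ (7 * n) * 2 ^ 9 := by ring
    have h2 : 2 ^ (2 * n + 26) ≤ 2 ^ (7 * n + 9) := Nat.pow_le_pow_right (by norm_num) (by omega)
    have e : 2 ^ (7 * n + 10) = 2 ^ (7 * n + 9) + 2 ^ (7 * n + 9) := by ring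
    omega
  · calc (n + 1) ^ 2 ≤ (n + 2) ^ 8 := by
          calc (n + 1) ^ 2 ≤ (n + 2) ^ 2 := Nat.pow_le_pow_left (by omega) 2
            _ ≤ (n + 2) ^ 8 := Nat.pow_le_pow_right (by omega) (by norm_num)
      _ ≤ 2 ^ n := pow_eight_le_two_pow_self hn

/-- `NC1nat` for `n ≥ 64`, in the subtraction-free parametrisation `r = s+1`, `n = s+2+t`. [folklore] -/
theorem nc1_large (s t : ℕ) (hn : 64 ≤ s + 2 + t) :
    (s + 1)! ^ 2 * (s + 2 + t) ^ (s + 1) * (s + 2 + t + 1)! * 2 ^ (s + 1) * s ! *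
        (2 ^ (4 * (s + 2 + t)) + 2 ^ 19) ^ (s + 1) * (264 * 87 ^ (s + 2 + t) + 2 ^ (2 * (s + 2 + t) + 26)) *
        (14 * (s + 2 + t) + 3) * (s + 2 + t + 2) ^ (4 * s) ≤
      256 ^ (t + 1) * (16 * (s + 2 + t + 1)) ^ s * 2 ^ (s + 2 + t + 22) * (t + 2)! *
        2 ^ ((s + 1) * (5 * (s + 2 + t) + 23)) := by
  set n := s + 2 + t with hn'
  obtain ⟨hb1, hb2, hb3, hb4⟩ := crude_bounds hn
  have h8 := pow_eight_le_two_pow_self hn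
  have hf : (n + 1)! ≤ (n + 1) ^ (s + 1) * (t + 2)! := by
    have := factorial_le_pow_mul_factorial (n := n) (j := s + 1) (by omega)
    rwa [show n + 1 - (s + 1) = t + 2 by omega] at this
  have hr1 : (s + 1)! ≤ (n + 2) ^ (s + 1) :=
    (Nat.factorial_le_pow _).trans (Nat.pow_le_pow_left (by omega) _)
  have hr2 : s ! ≤ (n + 2) ^ s := (Nat.factorial_le_pow _).trans (Nat.pow_le_pow_left (by omega) _)
  have hnp : n ^ (s + 1) ≤ (n + 2) ^ (s + 1) := Nat.pow_le_pow_left (by omega) _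
  have hE : (2 ^ (4 * n) + 2 ^ 19) ^ (s + 1) ≤ (2 ^ (4 * n + 1)) ^ (s + 1) := Nat.pow_le_pow_left hb1 _
  have step : (s + 1)! ^ 2 * n ^ (s + 1) * (n + 1)! * 2 ^ (s + 1) * s ! *
        (2 ^ (4 * n) + 2 ^ 19) ^ (s + 1) * (264 * 87 ^ n + 2 ^ (2 * n + 26)) * (14 * n + 3) *
        (n + 2) ^ (4 * s) ≤
      ((n + 2) ^ (s + 1)) ^ 2 * (n + 2) ^ (s + 1) * ((n + 1) ^ (s + 1) * (t + 2)!) * 2 ^ (s + 1) *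
        (n + 2) ^ s * (2 ^ (4 * n + 1)) ^ (s + 1) * 2 ^ (7 * n + 10) * (16 * (n + 1)) * (n + 2) ^ (4 * s) :=
    Nat.mul_le_mul (Nat.mul_le_mul (Nat.mul_le_mul (Nat.mul_le_mul (Nat.mul_le_mul (Nat.mul_le_mul
      (Nat.mul_le_mul (Nat.mul_le_mul (Nat.pow_le_pow_left hr1 2) hnp) hf) le_rfl) hr2) hE) hb2) hb3) le_rfl
  refine step.trans ?_
  -- `(n+2)^{8s+5} ≤ (2^n)^{s+1}`
  have hpoly : ((n + 2) ^ (s + 1)) ^ 2 * (n + 2) ^ (s + 1) * (n + 2) ^ s * (n + 2) ^ (4 * s) * (n + 1) ^ 2 ≤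
      (2 ^ n) ^ (s + 1) := by
    calc ((n + 2) ^ (s + 1)) ^ 2 * (n + 2) ^ (s + 1) * (n + 2) ^ s * (n + 2) ^ (4 * s) * (n + 1) ^ 2
        ≤ ((n + 2) ^ (s + 1)) ^ 2 * (n + 2) ^ (s + 1) * (n + 2) ^ s * (n + 2) ^ (4 * s) * (n + 2) ^ 2 :=
          Nat.mul_le_mul_left _ (Nat.pow_le_pow_left (by omega) 2)
      _ = (n + 2) ^ (8 * s + 5) := by ring
      _ ≤ (n + 2) ^ (8 * (s + 1)) := Nat.pow_le_pow_right (by omega) (by omega)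
      _ = ((n + 2) ^ 8) ^ (s + 1) := by rw [pow_mul]
      _ ≤ (2 ^ n) ^ (s + 1) := Nat.pow_le_pow_left h8 _
  -- exponent count: `n(s+1) + (4n+1)(s+1) + (s+1) + 7n + 14 + (19s+2t+25) = 8(t+1) + 4s + n + 22 + (s+1)(5n+23)`
  have hexp : (2 : ℕ) ^ n = 2 ^ (s + 2 + t) := by rw [hn']
  calc ((n + 2) ^ (s + 1)) ^ 2 * (n + 2) ^ (s + 1) * ((n + 1) ^ (s + 1) * (t + 2)!) * 2 ^ (s + 1) *
        (n + 2) ^ s * (2 ^ (4 * n + 1)) ^ (s + 1) * 2 ^ (7 * n + 10) * (16 * (n + 1)) * (n + 2) ^ (4 * s)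
      = (((n + 2) ^ (s + 1)) ^ 2 * (n + 2) ^ (s + 1) * (n + 2) ^ s * (n + 2) ^ (4 * s) * (n + 1) ^ 2) *
          ((n + 1) ^ s * (t + 2)!) * (16 * 2 ^ (s + 1) * (2 ^ (4 * n + 1)) ^ (s + 1) * 2 ^ (7 * n + 10)) := by
        ring
    _ ≤ (2 ^ n) ^ (s + 1) * ((n + 1) ^ s * (t + 2)!) *
          (16 * 2 ^ (s + 1) * (2 ^ (4 * n + 1)) ^ (s + 1) * 2 ^ (7 * n + 10)) :=
        Nat.mul_le_mul_right _ (Nat.mul_le_mul_right _ hpoly)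
    _ = ((n + 1) ^ s * (t + 2)!) * 2 ^ (n * (s + 1) + 4 + (s + 1) + (4 * n + 1) * (s + 1) + (7 * n + 10)) := by
        rw [← pow_mul, ← pow_mul, show (16 : ℕ) = 2 ^ 4 by norm_num]
        simp only [← pow_add]
        ring_nf
    _ ≤ ((n + 1) ^ s * (t + 2)!) *
          2 ^ (8 * (t + 1) + 4 * s + (n + 22) + (s + 1) * (5 * n + 23)) := by
        apply Nat.mul_le_mul_left
        apply Nat.pow_le_pow_right (by norm_num)
        rw [hn']; nlinarith
    _ = 256 ^ (t + 1) * (16 * (n + 1)) ^ s * 2 ^ (n + 22) * (t + 2)! * 2 ^ ((s + 1) * (5 * n + 23)) := by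
        rw [show (256 : ℕ) = 2 ^ 8 by norm_num, show (16 : ℕ) = 2 ^ 4 by norm_num, ← pow_mul, mul_pow,
          ← pow_mul]
        simp only [pow_add]
        ring

/-- `NC0nat` for `n ≥ 64`, in the parametrisation `r = s+1`, `n = s+2+t`. [folklore] -/
theorem nc0_large (s t : ℕ) (hn : 64 ≤ s + 2 + t) :
    (s + 1)! ^ 3 * (s + 2 + t) ^ (s + 1) * (s + 2 + t + 1)! * 2 ^ s *
        (2 ^ (4 * (s + 2 + t)) + 2 ^ 19) ^ (s + 1) * (264 * 87 ^ (s + 2 + t) + 2 ^ (2 * (s + 2 + t) + 26)) *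
        (14 * (s + 2 + t) + 3) * (s + 2 + t + 2) ^ (4 * (s + 1)) ≤
      256 ^ (t + 1) * (16 * (s + 2 + t + 1)) ^ (s + 1) * 2 ^ (s + 2 + t + 22) * (t + 1)! *
        2 ^ ((s + 1) * (5 * (s + 2 + t) + 23)) := by
  set n := s + 2 + t with hn'
  obtain ⟨hb1, hb2, hb3, hb4⟩ := crude_bounds hn
  have h8 := pow_eight_le_two_pow_self hn
  have hf : (n + 1)! ≤ (n + 1) ^ (s + 2) * (t + 1)! := by
    have := factorial_le_pow_mul_factorial (n := n) (j := s + 2) (by omega)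
    rwa [show n + 1 - (s + 2) = t + 1 by omega] at this
  have hr1 : (s + 1)! ≤ (n + 2) ^ (s + 1) :=
    (Nat.factorial_le_pow _).trans (Nat.pow_le_pow_left (by omega) _)
  have hnp : n ^ (s + 1) ≤ (n + 2) ^ (s + 1) := Nat.pow_le_pow_left (by omega) _
  have hE : (2 ^ (4 * n) + 2 ^ 19) ^ (s + 1) ≤ (2 ^ (4 * n + 1)) ^ (s + 1) := Nat.pow_le_pow_left hb1 _
  have step : (s + 1)! ^ 3 * n ^ (s + 1) * (n + 1)! * 2 ^ s *
        (2 ^ (4 * n) + 2 ^ 19) ^ (s + 1) * (264 * 87 ^ n + 2 ^ (2 * n + 26)) * (14 * n + 3) *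
        (n + 2) ^ (4 * (s + 1)) ≤
      ((n + 2) ^ (s + 1)) ^ 3 * (n + 2) ^ (s + 1) * ((n + 1) ^ (s + 2) * (t + 1)!) * 2 ^ s *
        (2 ^ (4 * n + 1)) ^ (s + 1) * 2 ^ (7 * n + 10) * (16 * (n + 1)) * (n + 2) ^ (4 * (s + 1)) :=
    Nat.mul_le_mul (Nat.mul_le_mul (Nat.mul_le_mul (Nat.mul_le_mul (Nat.mul_le_mul (Nat.mul_le_mul
      (Nat.mul_le_mul (Nat.pow_le_pow_left hr1 3) hnp) hf) le_rfl) hE) hb2) hb3) le_rfl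
  refine step.trans ?_
  have hpoly : ((n + 2) ^ (s + 1)) ^ 3 * (n + 2) ^ (s + 1) * (n + 2) ^ (4 * (s + 1)) * (n + 1) ^ 2 ≤
      (2 ^ n) ^ (s + 2) := by
    calc ((n + 2) ^ (s + 1)) ^ 3 * (n + 2) ^ (s + 1) * (n + 2) ^ (4 * (s + 1)) * (n + 1) ^ 2
        ≤ ((n + 2) ^ (s + 1)) ^ 3 * (n + 2) ^ (s + 1) * (n + 2) ^ (4 * (s + 1)) * (n + 2) ^ 2 :=
          Nat.mul_le_mul_left _ (Nat.pow_le_pow_left (by omega) 2)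
      _ = (n + 2) ^ (8 * s + 10) := by ring
      _ ≤ (n + 2) ^ (8 * (s + 2)) := Nat.pow_le_pow_right (by omega) (by omega)
      _ = ((n + 2) ^ 8) ^ (s + 2) := by rw [pow_mul]
      _ ≤ (2 ^ n) ^ (s + 2) := Nat.pow_le_pow_left h8 _
  calc ((n + 2) ^ (s + 1)) ^ 3 * (n + 2) ^ (s + 1) * ((n + 1) ^ (s + 2) * (t + 1)!) * 2 ^ s *
        (2 ^ (4 * n + 1)) ^ (s + 1) * 2 ^ (7 * n + 10) * (16 * (n + 1)) * (n + 2) ^ (4 * (s + 1))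
      = (((n + 2) ^ (s + 1)) ^ 3 * (n + 2) ^ (s + 1) * (n + 2) ^ (4 * (s + 1)) * (n + 1) ^ 2) *
          ((n + 1) ^ (s + 1) * (t + 1)!) * (16 * 2 ^ s * (2 ^ (4 * n + 1)) ^ (s + 1) * 2 ^ (7 * n + 10)) := by
        ring
    _ ≤ (2 ^ n) ^ (s + 2) * ((n + 1) ^ (s + 1) * (t + 1)!) *
          (16 * 2 ^ s * (2 ^ (4 * n + 1)) ^ (s + 1) * 2 ^ (7 * n + 10)) :=
        Nat.mul_le_mul_right _ (Nat.mul_le_mul_right _ hpoly)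
    _ = ((n + 1) ^ (s + 1) * (t + 1)!) * 2 ^ (n * (s + 2) + 4 + s + (4 * n + 1) * (s + 1) + (7 * n + 10)) := by
        rw [← pow_mul, ← pow_mul, show (16 : ℕ) = 2 ^ 4 by norm_num]
        simp only [← pow_add]
        ring_nf
    _ ≤ ((n + 1) ^ (s + 1) * (t + 1)!) *
          2 ^ (8 * (t + 1) + 4 * (s + 1) + (n + 22) + (s + 1) * (5 * n + 23)) := by
        apply Nat.mul_le_mul_left
        apply Nat.pow_le_pow_right (by norm_num)
        rw [hn']; nlinarith
    _ = 256 ^ (t + 1) * (16 * (n + 1)) ^ (s + 1) * 2 ^ (n + 22) * (t + 1)! * 2 ^ ((s + 1) * (5 * n + 23)) := by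
        rw [show (256 : ℕ) = 2 ^ 8 by norm_num, show (16 : ℕ) = 2 ^ 4 by norm_num, ← pow_mul, mul_pow,
          ← pow_mul]
        simp only [pow_add]
        ring

/-- **`NC1nat n r`** for all `0 < r < n`. [folklore] -/
theorem nc1_nat (n r : ℕ) (hr0 : 0 < r) (hrn : r < n) :
    r ! ^ 2 * n ^ r * (n + 1)! * 2 ^ r * (r - 1)! * (2 ^ (4 * n) + 2 ^ 19) ^ r *
        (264 * 87 ^ n + 2 ^ (2 * n + 26)) * (14 * n + 3) * (n + 2) ^ (4 * (r - 1)) ≤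
      256 ^ (n - r) * (16 * (n + 1)) ^ (r - 1) * 2 ^ (n + 22) * (n - r + 1)! * 2 ^ (r * (5 * n + 23)) := by
  rcases Nat.lt_or_ge n 65 with hn | hn
  · exact (nc_small n (by omega) r hrn hr0).1
  · obtain ⟨s, rfl⟩ : ∃ s, r = s + 1 := ⟨r - 1, by omega⟩
    obtain ⟨t, rfl⟩ : ∃ t, n = s + 2 + t := ⟨n - s - 2, by omega⟩
    have e1 : s + 1 - 1 = s := by omega
    have e2 : s + 2 + t - (s + 1) = t + 1 := by omega
    rw [e1, e2]
    exact nc1_large s t (by omega)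

/-- **`NC0nat n r`** for all `0 < r < n`. [folklore] -/
theorem nc0_nat (n r : ℕ) (hr0 : 0 < r) (hrn : r < n) :
    r ! ^ 3 * n ^ r * (n + 1)! * 2 ^ (r - 1) * (2 ^ (4 * n) + 2 ^ 19) ^ r *
        (264 * 87 ^ n + 2 ^ (2 * n + 26)) * (14 * n + 3) * (n + 2) ^ (4 * r) ≤
      256 ^ (n - r) * (16 * (n + 1)) ^ r * 2 ^ (n + 22) * (n - r)! * 2 ^ (r * (5 * n + 23)) := by
  rcases Nat.lt_or_ge n 65 with hn | hn
  · exact (nc_small n (by omega) r hrn hr0).2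
  · obtain ⟨s, rfl⟩ : ∃ s, r = s + 1 := ⟨r - 1, by omega⟩
    obtain ⟨t, rfl⟩ : ∃ t, n = s + 2 + t := ⟨n - s - 2, by omega⟩
    have e1 : s + 1 - 1 = s := by omega
    have e2 : s + 2 + t - (s + 1) = t + 1 := by omega
    rw [e1, e2]
    exact nc0_large s t (by omega)

end RecordExitsNumeric

namespace PadicG3Par

/-! ### Back to the reals: the hypotheses `hnum1`, `hnum0` -/

/-- `λ ≤ (2^{4n} + 2^{19})/2^{5n+23}` and `c_L ≤ 264·87ⁿ + 2^{2n+26}` (`64 ≤ Cb ≤ 87`). [folklore] -/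
theorem lam_cL_le (n : ℕ) :
    ((2 : ℝ) ^ (n + 23))⁻¹ + 2 ^ n / (24 * Cb ^ n) ≤ ((2 : ℝ) ^ (4 * n) + 2 ^ 19) / 2 ^ (5 * n + 23) ∧
    264 * Cb ^ n + (2 : ℝ) ^ (2 * n + 26) ≤ 264 * 87 ^ n + 2 ^ (2 * n + 26) := by
  have h64 := sixtyfour_le_Cb
  have h87 := Cb_le
  have hCb0 : (0 : ℝ) ≤ Cb := by linarith
  constructor
  · have hCbn : (64 : ℝ) ^ n ≤ Cb ^ n := pow_le_pow_left₀ (by norm_num) h64 n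
    have hpos : (0 : ℝ) < 24 * Cb ^ n := by positivity
    rw [add_div]
    apply _root_.add_le_add
    · rw [inv_eq_one_div, div_le_div_iff₀ (by positivity) (by positivity)]
      rw [one_mul, ← pow_add]; ring_nf; exact le_rfl
    · rw [div_le_div_iff₀ hpos (by positivity)]
      have e : (2 : ℝ) ^ (5 * n + 23) = 2 ^ (5 * n + 4) * 2 ^ 19 := by rw [← pow_add]
      have e2 : (2 : ℝ) ^ n * 2 ^ (5 * n + 4) = 16 * 64 ^ n := by
        rw [← pow_add, show n + (5 * n + 4) = 6 * n + 4 by ring, pow_add, pow_mul]; norm_num; ring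
      calc (2 : ℝ) ^ n * 2 ^ (5 * n + 23) = (2 ^ n * 2 ^ (5 * n + 4)) * 2 ^ 19 := by rw [e]; ring
        _ = 16 * 64 ^ n * 2 ^ 19 := by rw [e2]
        _ ≤ 24 * Cb ^ n * 2 ^ 19 := by nlinarith [pow_nonneg hCb0 n]
        _ = 2 ^ 19 * (24 * Cb ^ n) := by ring
  · have : Cb ^ n ≤ (87 : ℝ) ^ n := pow_le_pow_left₀ hCb0 h87 n
    linarith

/-- **`hnum1`** of `recordTwo_of_numeric`/`recordOdd_of_numeric`, for all `0 < r < n`. [folklore] -/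
theorem hnum1_holds (n r : ℕ) (hr0 : 0 < r) (hrn : r < n) :
    ((r ! : ℕ) : ℝ) ^ 2 * (n : ℝ) ^ r * (((n + 1)! : ℕ) : ℝ) * 2 ^ r * (((r - 1)! : ℕ) : ℝ) *
        (((2 : ℝ) ^ (n + 23))⁻¹ + 2 ^ n / (24 * Cb ^ n)) ^ r * (264 * Cb ^ n + 2 ^ (2 * n + 26)) *
        (14 * n + 3) ≤
      (256 : ℝ) ^ (n - r) * (16 * ((n : ℝ) + 1) / ((n : ℝ) + 2) ^ 4) ^ (r - 1) * 2 ^ (n + 22) *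
        (((n - r + 1)! : ℕ) : ℝ) := by
  obtain ⟨hlam, hcL⟩ := lam_cL_le n
  have hnat := RecordExitsNumeric.nc1_nat n r hr0 hrn
  have hR : ((r ! ^ 2 * n ^ r * (n + 1)! * 2 ^ r * (r - 1)! * (2 ^ (4 * n) + 2 ^ 19) ^ r *
      (264 * 87 ^ n + 2 ^ (2 * n + 26)) * (14 * n + 3) * (n + 2) ^ (4 * (r - 1)) : ℕ) : ℝ) ≤
      ((256 ^ (n - r) * (16 * (n + 1)) ^ (r - 1) * 2 ^ (n + 22) * (n - r + 1)! * 2 ^ (r * (5 * n + 23)) : ℕ)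
        : ℝ) := by exact_mod_cast hnat
  push_cast at hR
  have hlam0 : (0 : ℝ) ≤ ((2 : ℝ) ^ (n + 23))⁻¹ + 2 ^ n / (24 * Cb ^ n) := by
    have := sixtyfour_le_Cb; positivity
  have hK : 0 ≤ ((r ! : ℕ) : ℝ) ^ 2 * (n : ℝ) ^ r * (((n + 1)! : ℕ) : ℝ) * 2 ^ r * (((r - 1)! : ℕ) : ℝ) := by
    positivity
  -- replace `λ`, `c_L` by their rational bounds
  have h1 : ((r ! : ℕ) : ℝ) ^ 2 * (n : ℝ) ^ r * (((n + 1)! : ℕ) : ℝ) * 2 ^ r * (((r - 1)! : ℕ) : ℝ) *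
        (((2 : ℝ) ^ (n + 23))⁻¹ + 2 ^ n / (24 * Cb ^ n)) ^ r * (264 * Cb ^ n + 2 ^ (2 * n + 26)) *
        (14 * n + 3) ≤
      ((r ! : ℕ) : ℝ) ^ 2 * (n : ℝ) ^ r * (((n + 1)! : ℕ) : ℝ) * 2 ^ r * (((r - 1)! : ℕ) : ℝ) *
        (((2 : ℝ) ^ (4 * n) + 2 ^ 19) / 2 ^ (5 * n + 23)) ^ r * (264 * 87 ^ n + 2 ^ (2 * n + 26)) *
        (14 * n + 3) := by
    have hcL0 : (0 : ℝ) ≤ 264 * Cb ^ n + 2 ^ (2 * n + 26) := by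
      have := sixtyfour_le_Cb; positivity
    gcongr
  refine h1.trans ?_
  -- clear denominators
  have hd1 : (0 : ℝ) < (2 ^ (5 * n + 23)) ^ r := by positivity
  have hd2 : (0 : ℝ) < ((n : ℝ) + 2) ^ (4 * (r - 1)) := by positivity
  rw [div_pow, div_pow, show (((n : ℝ) + 2) ^ 4) ^ (r - 1) = ((n : ℝ) + 2) ^ (4 * (r - 1)) by rw [← pow_mul]]
  rw [show ((r ! : ℕ) : ℝ) ^ 2 * (n : ℝ) ^ r * (((n + 1)! : ℕ) : ℝ) * 2 ^ r * (((r - 1)! : ℕ) : ℝ) *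
        (((2 : ℝ) ^ (4 * n) + 2 ^ 19) ^ r / (2 ^ (5 * n + 23)) ^ r) * (264 * 87 ^ n + 2 ^ (2 * n + 26)) *
        (14 * n + 3) =
      (((r ! : ℕ) : ℝ) ^ 2 * (n : ℝ) ^ r * (((n + 1)! : ℕ) : ℝ) * 2 ^ r * (((r - 1)! : ℕ) : ℝ) *
        ((2 : ℝ) ^ (4 * n) + 2 ^ 19) ^ r * (264 * 87 ^ n + 2 ^ (2 * n + 26)) * (14 * n + 3)) /
        (2 ^ (5 * n + 23)) ^ r by field_simp]
  rw [show (256 : ℝ) ^ (n - r) * ((16 * ((n : ℝ) + 1)) ^ (r - 1) / ((n : ℝ) + 2) ^ (4 * (r - 1))) *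
        2 ^ (n + 22) * (((n - r + 1)! : ℕ) : ℝ) =
      ((256 : ℝ) ^ (n - r) * (16 * ((n : ℝ) + 1)) ^ (r - 1) * 2 ^ (n + 22) * (((n - r + 1)! : ℕ) : ℝ)) /
        ((n : ℝ) + 2) ^ (4 * (r - 1)) by field_simp]
  rw [div_le_div_iff₀ hd1 hd2, ← pow_mul, show (5 * n + 23) * r = r * (5 * n + 23) by ring]
  have e19 : (524288 : ℝ) = 2 ^ 19 := by norm_num
  rw [e19] at hR
  linarith [hR]

/-- **`hnum0`** of `recordTwo_of_numeric`/`recordOdd_of_numeric`, for all `0 < r < n`. [folklore] -/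
theorem hnum0_holds (n r : ℕ) (hr0 : 0 < r) (hrn : r < n) :
    ((r ! : ℕ) : ℝ) ^ 3 * (n : ℝ) ^ r * (((n + 1)! : ℕ) : ℝ) * 2 ^ (r - 1) *
        (((2 : ℝ) ^ (n + 23))⁻¹ + 2 ^ n / (24 * Cb ^ n)) ^ r * (264 * Cb ^ n + 2 ^ (2 * n + 26)) *
        (14 * n + 3) ≤
      (256 : ℝ) ^ (n - r) * (16 * ((n : ℝ) + 1) / ((n : ℝ) + 2) ^ 4) ^ r * 2 ^ (n + 22) *
        (((n - r)! : ℕ) : ℝ) := by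
  obtain ⟨hlam, hcL⟩ := lam_cL_le n
  have hnat := RecordExitsNumeric.nc0_nat n r hr0 hrn
  have hR : ((r ! ^ 3 * n ^ r * (n + 1)! * 2 ^ (r - 1) * (2 ^ (4 * n) + 2 ^ 19) ^ r *
      (264 * 87 ^ n + 2 ^ (2 * n + 26)) * (14 * n + 3) * (n + 2) ^ (4 * r) : ℕ) : ℝ) ≤
      ((256 ^ (n - r) * (16 * (n + 1)) ^ r * 2 ^ (n + 22) * (n - r)! * 2 ^ (r * (5 * n + 23)) : ℕ) : ℝ) := by
    exact_mod_cast hnat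
  push_cast at hR
  have hlam0 : (0 : ℝ) ≤ ((2 : ℝ) ^ (n + 23))⁻¹ + 2 ^ n / (24 * Cb ^ n) := by
    have := sixtyfour_le_Cb; positivity
  have h1 : ((r ! : ℕ) : ℝ) ^ 3 * (n : ℝ) ^ r * (((n + 1)! : ℕ) : ℝ) * 2 ^ (r - 1) *
        (((2 : ℝ) ^ (n + 23))⁻¹ + 2 ^ n / (24 * Cb ^ n)) ^ r * (264 * Cb ^ n + 2 ^ (2 * n + 26)) *
        (14 * n + 3) ≤
      ((r ! : ℕ) : ℝ) ^ 3 * (n : ℝ) ^ r * (((n + 1)! : ℕ) : ℝ) * 2 ^ (r - 1) *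
        (((2 : ℝ) ^ (4 * n) + 2 ^ 19) / 2 ^ (5 * n + 23)) ^ r * (264 * 87 ^ n + 2 ^ (2 * n + 26)) *
        (14 * n + 3) := by
    have hcL0 : (0 : ℝ) ≤ 264 * Cb ^ n + 2 ^ (2 * n + 26) := by
      have := sixtyfour_le_Cb; positivity
    gcongr
  refine h1.trans ?_
  have hd1 : (0 : ℝ) < (2 ^ (5 * n + 23)) ^ r := by positivity
  have hd2 : (0 : ℝ) < ((n : ℝ) + 2) ^ (4 * r) := by positivity
  rw [div_pow, div_pow, show (((n : ℝ) + 2) ^ 4) ^ r = ((n : ℝ) + 2) ^ (4 * r) by rw [← pow_mul]]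
  rw [show ((r ! : ℕ) : ℝ) ^ 3 * (n : ℝ) ^ r * (((n + 1)! : ℕ) : ℝ) * 2 ^ (r - 1) *
        (((2 : ℝ) ^ (4 * n) + 2 ^ 19) ^ r / (2 ^ (5 * n + 23)) ^ r) * (264 * 87 ^ n + 2 ^ (2 * n + 26)) *
        (14 * n + 3) =
      (((r ! : ℕ) : ℝ) ^ 3 * (n : ℝ) ^ r * (((n + 1)! : ℕ) : ℝ) * 2 ^ (r - 1) *
        ((2 : ℝ) ^ (4 * n) + 2 ^ 19) ^ r * (264 * 87 ^ n + 2 ^ (2 * n + 26)) * (14 * n + 3)) /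
        (2 ^ (5 * n + 23)) ^ r by field_simp]
  rw [show (256 : ℝ) ^ (n - r) * ((16 * ((n : ℝ) + 1)) ^ r / ((n : ℝ) + 2) ^ (4 * r)) *
        2 ^ (n + 22) * (((n - r)! : ℕ) : ℝ) =
      ((256 : ℝ) ^ (n - r) * (16 * ((n : ℝ) + 1)) ^ r * 2 ^ (n + 22) * (((n - r)! : ℕ) : ℝ)) /
        ((n : ℝ) + 2) ^ (4 * r) by field_simp]
  rw [div_le_div_iff₀ hd1 hd2, ← pow_mul, show (5 * n + 23) * r = r * (5 * n + 23) by ring]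
  have e19 : (524288 : ℝ) = 2 ^ 19 := by norm_num
  rw [e19] at hR
  linarith [hR]

open Summit.ABC.StewartYu.GenThreeFrameSpecTwo (RecordTwo)
open Summit.ABC.StewartYu.GenThreeFrameSpecOdd (RecordOdd)

variable {n : ℕ} (P : PadicG3Par n)

/-- **`RecordTwo` BY NAME for `PadicG3Par` from the instantiation convention and an admissible geometric
constant alone** (the numerics of Nesterenko's Lemmas 5.3, 5.4 and the (5.22) line, all discharged).
[cite: Nesterenko2003, §5.2 (5.13)–(5.22), Lemmas 5.3–5.4] -/
theorem recordTwo_of_convention (hKNq : P.K ≤ P.Nq) (hNqK : P.Nq ≤ 2 ^ n * P.K)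
    (hθ : (1 / 2 : ℝ) ≤ P.θ₀) (hAmax : P.Amax ≤ 2 ^ n * P.Ω) (hA1 : ∀ j, 1 ≤ P.A j)
    {C : ℕ → ℝ} (hC0 : ∀ r, 0 ≤ C r) (hCg : ∀ r, r < n → (256 : ℝ) ^ (n - r) * C r ≤ C n) :
    RecordTwo C n P.A P.Amax P.W P.D₀ P.S₀N P.Xfin P.D :=
  P.recordTwo_of_numeric hKNq hNqK hθ hAmax hA1 hC0 hCg
    (fun r h0 h => hnum1_holds n r h0 h)
    (fun r h0 h => hnum0_holds n r h0 h)

/-- **`RecordOdd` BY NAME for `PadicG3Par`** (any `p`), same hypotheses.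
[cite: Nesterenko2003, §5.2 (5.13)–(5.22), Lemmas 5.3–5.4] -/
theorem recordOdd_of_convention (hKNq : P.K ≤ P.Nq) (hNqK : P.Nq ≤ 2 ^ n * P.K)
    (hθ : (1 / 2 : ℝ) ≤ P.θ₀) (hAmax : P.Amax ≤ 2 ^ n * P.Ω) (hA1 : ∀ j, 1 ≤ P.A j) (p : ℕ)
    {C : ℕ → ℝ} (hC0 : ∀ r, 0 ≤ C r) (hCg : ∀ r, r < n → (256 : ℝ) ^ (n - r) * C r ≤ C n) :
    RecordOdd C p n P.A P.Amax P.W P.D₀ P.S₀N P.Xfin P.D :=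
  P.recordOdd_of_numeric hKNq hNqK hθ hAmax hA1 p hC0 hCg
    (fun r h0 h => hnum1_holds n r h0 h)
    (fun r h0 h => hnum0_holds n r h0 h)

end PadicG3Par


end Summit.ABC.StewartYu

end
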